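import Literature.Geometry.Lorentzian.CurvatureSymmetries
import HarnessLib

/-!
# Locality of the Levi-Civita connection in the differentiated section

The tree's Levi-Civita connection `PseudoRiemannianMetric.leviCivita` (`LeviCivita.lean`: the Koszul
functional on `FiberBundle.extend`ed tangent vectors, packaged through a `dite` on representability) depends
only on the GERM of the differentiated section at the point: if `Y =ᶠ[𝓝 x] Y'` then `∇Y(x) = ∇Y'(x)`.
This is the locality half of O'Neill's Prop. 3.18 / the remark after Thm. 3.11 ("`(∇_V W)_p` depends only
on the values of `W` in a neighbourhood of `p`"), needed whenever vector fields are GLUED from local pieces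
(e.g. patching local Killing fields): the Killing equation of the glued field at `x` is that of the piece.

* `PseudoRiemannianMetric.koszulFunctional_congr_nhds` — `K(X, Y, Z)(x)` only sees the germ of `Y` at `x`;
* `PseudoRiemannianMetric.leviCivitaFun_congr_nhds`, `PseudoRiemannianMetric.leviCivita_congr_nhds` —
  `∇Y(x)` only sees the germ of `Y` at `x`.

Everything is proved (each term of the Koszul functional is a first derivative at `x` of functions agreeing
near `x` — `mvfderiv_congr_of_eventuallyEq` of `CurvatureSymmetries.lean` — or a Lie bracket at `x` of
fields agreeing near `x` — Mathlib's `Filter.EventuallyEq.mlieBracket_vectorField_eq`).  Not here: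
locality in the direction argument (that is tensoriality, `koszulFunctional_tensorial₁`), and the congruence
under change of METRIC (`MetricValCongr.lean`, `leviCivita_congr_of_val_eq`).

## References

* B. O'Neill, *Semi-Riemannian geometry with applications to relativity*, Academic Press 1983, Ch. 3,
  Thm. 3.11 (Koszul formula) and Prop. 3.18 with the preceding remark (locality of `∇_V W` in `W`).
-/

noncomputable section

open Bundle Set Filter
open scoped Manifold ContDiff Topology

namespace Literature.Geometry.Lorentzian

variable {E : Type*} [NormedAddCommGroup E] [NormedSpace ℝ E] {H : Type*} [TopologicalSpace H]
  {I : ModelWithCorners ℝ E H} {M : Type*} [TopologicalSpace M] [ChartedSpace H M]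
  [IsManifold I ∞ M] {n : ℕ∞ω} {x : M}

namespace PseudoRiemannianMetric

variable (g : PseudoRiemannianMetric I n E (TangentSpace I : M → Type _))

/-- **The Koszul functional is local in its middle argument**: if `Y =ᶠ[𝓝 x] Y'` then
`K(X, Y, Z)(x) = K(X, Y', Z)(x)` — each of its six terms is a first derivative at `x` of a function agreeing
near `x`, or a Lie bracket at `x` of fields agreeing near `x`, or a value at `x`. O'Neill 1983, Ch. 3,
Thm. 3.11 (the Koszul formula) with the locality remark before Prop. 3.18. [cite: ONeill1983, Ch. 3, Thm. 3.11] -/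
theorem koszulFunctional_congr_nhds {X Y Y' Z : Π x : M, TangentSpace I x} (h : Y =ᶠ[𝓝 x] Y') :
    g.koszulFunctional X Y Z x = g.koszulFunctional X Y' Z x := by
  unfold koszulFunctional
  have hx : Y x = Y' x := h.eq_of_nhds
  have h1 : (fun y ↦ g.val y (Y y) (Z y)) =ᶠ[𝓝 x] (fun y ↦ g.val y (Y' y) (Z y)) := by
    filter_upwards [h] with y hy; rw [hy]
  have h3 : (fun y ↦ g.val y (X y) (Y y)) =ᶠ[𝓝 x] (fun y ↦ g.val y (X y) (Y' y)) := by
    filter_upwards [h] with y hy; rw [hy]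
  have h4 : VectorField.mlieBracket I Y Z x = VectorField.mlieBracket I Y' Z x :=
    h.mlieBracket_vectorField_eq EventuallyEq.rfl
  have h6 : VectorField.mlieBracket I X Y x = VectorField.mlieBracket I X Y' x :=
    EventuallyEq.rfl.mlieBracket_vectorField_eq h
  rw [mvfderiv_congr_of_eventuallyEq h1, mvfderiv_congr_of_eventuallyEq h3, h4, h6, hx]

open scoped Classical in
/-- **`leviCivitaFun g Y x` is local in `Y`**: it only sees the germ of `Y` at `x` (the representability
condition and the represented functional in its defining `dite` are the Koszul functional on extended vectors,
local by `koszulFunctional_congr_nhds`). O'Neill 1983, Ch. 3, remark before Prop. 3.18. [cite: ONeill1983, Ch. 3, Prop. 3.18] -/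
theorem leviCivitaFun_congr_nhds {Y Y' : Π x : M, TangentSpace I x} (h : Y =ᶠ[𝓝 x] Y') :
    g.leviCivitaFun Y x = g.leviCivitaFun Y' x := by
  have hF : (fun (X₀ Z₀ : TangentSpace I x) ↦
      g.koszulFunctional (FiberBundle.extend E X₀) Y (FiberBundle.extend E Z₀) x) =
      (fun X₀ Z₀ ↦ g.koszulFunctional (FiberBundle.extend E X₀) Y' (FiberBundle.extend E Z₀) x) := by
    funext X₀ Z₀; exact koszulFunctional_congr_nhds g h
  have key : ∀ (F F' : TangentSpace I x → TangentSpace I x → ℝ), F = F' →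
      (dite (∃ A : TangentSpace I x →L[ℝ] TangentSpace I x, ∀ X₀ Z₀, 2 * g.val x (A X₀) Z₀ = F X₀ Z₀)
        (fun h ↦ h.choose) (fun _ ↦ 0)) =
      dite (∃ A : TangentSpace I x →L[ℝ] TangentSpace I x, ∀ X₀ Z₀, 2 * g.val x (A X₀) Z₀ = F' X₀ Z₀)
        (fun h ↦ h.choose) (fun _ ↦ 0) := by
    rintro F F' rfl; rfl
  unfold leviCivitaFun
  exact key (fun X₀ Z₀ ↦ g.koszulFunctional (FiberBundle.extend E X₀) Y (FiberBundle.extend E Z₀) x)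
    (fun X₀ Z₀ ↦ g.koszulFunctional (FiberBundle.extend E X₀) Y' (FiberBundle.extend E Z₀) x) hF

/-- **Locality of the Levi-Civita connection in the differentiated section**: if `Y =ᶠ[𝓝 x] Y'` then
`∇Y(x) = ∇Y'(x)` for the tree's `PseudoRiemannianMetric.leviCivita` (as continuous linear maps
`T_x M →L T_x M`, i.e. `∇_v Y = ∇_v Y'` for every `v`). O'Neill 1983, Ch. 3, remark before Prop. 3.18
("`(∇_V W)_p` depends only on the values of `W` in a neighbourhood of `p`"). [cite: ONeill1983, Ch. 3, Prop. 3.18] -/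
theorem leviCivita_congr_nhds [FiniteDimensional ℝ E] [CompleteSpace E] [Fact (1 ≤ n)] [g.HasLeviCivita]
    {Y Y' : Π x : M, TangentSpace I x} (h : Y =ᶠ[𝓝 x] Y') : g.leviCivita Y x = g.leviCivita Y' x := by
  rw [leviCivita_apply, leviCivita_apply]
  exact leviCivitaFun_congr_nhds g h

end PseudoRiemannianMetric

end Literature.Geometry.Lorentzian

end
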